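/-
Copyright (c) 2026 the pub-hodgecm-mathlib formalisation cell (harness21).  Prover seat hodgecm-mathlib-LH4-p13 (g8), req620 Track A «(D-RAM) FOUR-FRAME» squad, tier 0,
STAGE-1b PRE-SCOPING (heir LEAD F0P3a-plan (g20) T19-24∕T19-31 (R-29)(b); dealer LH4-plan (g12) WORD #45∕#50 «(α) pointwise ↦ p13»): organ (L-lab) «THE LABEL LAW» — brick
(L-lab-9) «THE TWO-CLASS OBSTRUCTION»: a value set that contains `e₁·t₊` and `e₂·t₊` with `e₁∕e₂ ∉ N(E^×)` is the value set of NO scalar multiple `c • X₊` of the reference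
nilpotent — no `LabelPlus`, no «LabelMinus′» (the membership form of ★ `not_labelPlus_smul_xPlus`).  2026-09-04.
-/
import Summits.HodgeConjecture.HodgeConjecture.Theorems.F0P3cDyRamHeisenbergShellValueSet   -- ★ p859171 (this seat, (L-lab-6)): brings ★ (L-lab-3) `valueSetMod_smul_xPlus`, ★ `not_labelPlus_smul_xPlus`'s inputs
                                                                                            -- (★ `exists_mul_map_eq_of_isRamifiedQuadraticDatum`, ★ `v_refSkewScalar`, ★ `v_inv_varpi_pow_mul_le_one_iff`), ★ №3 Pieces, ★ U2G DEFS `latticeValueSetMod`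
import HarnessLib

/-!
# Crux `H413`, line LH4 «(D-RAM) FOUR-FRAME», tier 0, STAGE-1b pre-scoping — (L-lab-9) «THE TWO-CLASS OBSTRUCTION»: two values `e₁·t₊`, `e₂·t₊` of different norm classes
# in one value set exclude EVERY transvection class at the level of record

Cell `hodgecm-mathlib` (D-0151), FLOOR 0, crux item H413 = `stmt-HodgeConjecture-24833`, route of record `HCCMUnconditional`; squad F0∕P3c∕LH4.  SCOPING INVENTORY for the
STAGE-1b directive (the set identity (α) of the DERIVED road for `stub_rows_transvPlus`, heir LEAD T19-31 (R-29)(b), F0P3-p01 (g35) TEMPLATE-LAWS §2; dealer WORD #50 «(α)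
pointwise ↦ p13 (g8)»).  THEOREMS ONLY (no `def`, no instance, no notation, no `sorry`, default heartbeats), ★-only imports, lane `--supports stmt-HodgeConjecture-24833 --as helper`;
pays NO row, states NO law.

WHY.  The label of `X` at the level of record `m* = d % 2 + 2d − 1` asks whether the `ϖ^{m*}`-thickened value set of `y ↦ ⟨y, Xy⟩_{Φ₃}` equals that of `X₊ = t₊·E₀₂` (class `+`,
★ №3 `LabelPlus`) or of `c₀ • X₊`, `c₀` a non-norm unit (class `−`, «LabelMinus′»).  ★ (L-lab-8) (p859272) decides when the value set LEAVES the skew line (no class).  This file is the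
complementary obstruction ON the skew line: by the conductor-`d` arithmetic of ★ `not_labelPlus_smul_xPlus` (Serre V §3 Cor. 3: `σ`-fixed one-units of level `2d` are norms), a
`σ`-fixed unit multiple `e·t₊` lies in the value set of `e′ • X₊` modulo `ϖ^{m*}` only if `e∕e′` is a NORM (§1–§2).  Hence (§3–§4) a value set — on `𝒪³` (★ №3 `valueSetMod`, the piece
predicate) or on a lattice `M` (★ U2G `latticeValueSetMod`, the census predicate) — that contains `e₁·t₊` AND `e₂·t₊` with `e₁∕e₂ ∉ N(E^×)` equals `valueSetMod σ ϖ m* (c • X₊)` for NO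
`σ`-fixed unit `c`: NEITHER `LabelPlus` NOR «LabelMinus′».  This is the tool that (i) decides the TWO-SLOT strata of (α₁) (a binary norm form `c₀(α−1)N(y₀) + c₁(β−1)N(y₁)` whose
two slots are both visible at precision `2d − 1` with classes that differ has no label — ★ p859223 (L-lab-7) model), and (ii) carries this seat's 10:15:13Z witness that (α) is FALSE
POINTWISE ON `K` (`u = (1 + X₊)·diag(1, β, 1)`, `v(β − 1) = m* − 1`: clean by level, values `t₊(N(a) + e₁N(b))` of both classes) — so (α) is typed on the near-1 POPULATIONS.

* §1 **`exists_norm_eq_div_of_near`** — `|(ϖ^{m*})⁻¹·(e·t₊ − e′·t₊·N(a))| ≤ 1` for `σ`-fixed units `e, e′` and an integral… any `a` ⇒ `e∕e′ ∈ N(E^×)` (the arithmetic core of ★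
  `not_labelPlus_smul_xPlus`, made two-sided and membership-shaped).
* §2 **`exists_norm_of_mem_valueSetMod_smul_xPlus`** — `e·t₊ ∈ valueSetMod σ ϖ m* (e′ • X₊) ⇒ e∕e′ ∈ N(E^×)`; `smul_refSkewScalar_mem_valueSetMod_smul_xPlus` (`e·t₊ ∈ valueSetMod (e • X₊)`).
* §3 **`valueSetMod_ne_smul_xPlus_of_two_classes`**, `not_labelPlus_of_two_classes` (on `𝒪³`).
* §4 **`latticeValueSetMod_ne_smul_xPlus_of_two_classes`**, `not_latticeLabelPlus_of_two_classes` (at a lattice).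
HONEST LABEL.  Count-neutral scoping brick; the three tier-0 rows stay OPEN; `HC_CM` is proved only modulo the 7 printed citations (2 remaining named inputs: hLiu418 =
`stmt-HodgeConjecture-24832`, h413 = `stmt-HodgeConjecture-24833`) until rung 0 closes.

## References
* [Serre1979] J.-P. Serre, *Local Fields*, GTM 67 (1979), Ch. V §3 Cor. 3 (norm groups of a totally ramified quadratic extension; conductor), Ch. XV §2 (the norm groups).
* [Rogawski1990] J. D. Rogawski, *Automorphic Representations of Unitary Groups in Three Variables*, Ann. of Math. Stud. 123 (1990), §4.9 Prop. 4.9.1 (b) p. 55 (the two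
  transvection classes).
* [LanglandsShelstad1987] R. P. Langlands, D. Shelstad, *On the definition of transfer factors*, Math. Ann. 278 (1987), §3 (the sign attached to the two unipotent classes).
* [Kottwitz1986BaseChangeUnits] R. E. Kottwitz, *Base change for unit elements of Hecke algebras*, Compositio Math. 60 (1986), §1 pp. 240–241.
-/

set_option autoImplicit false

noncomputable section

namespace Summit.HodgeConjecture.HodgeConjecture.Cruxes.H413.F0P3cDyRamValueSetTwoClassObstruction

open Literature.NumberTheory.Automorphic Literature.NumberTheory.Automorphic.HermitianLattice
open Literature.NumberTheory.Automorphic.UnitaryLatticeTree Literature.NumberTheory.Automorphic.UnitaryThreeFourFrame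
open Literature.NumberTheory.LocalFields Literature.NumberTheory.LocalFields.WildQuadraticDatum
open Summit.HodgeConjecture.HodgeConjecture.Cruxes.H413.F0P3cDyRamFourFramePieces
open Summit.HodgeConjecture.HodgeConjecture.Cruxes.H413.F0P3cDyRamFourFrameCensusDefs
open Summit.HodgeConjecture.HodgeConjecture.Cruxes.H413.F0P3cDyRamShellLabelPlus (v_inv_varpi_pow_mul_le_one_iff)
open Summit.HodgeConjecture.HodgeConjecture.Cruxes.H413.F0P3cDyRamSmulXPlusLabel (valueSetMod_smul_xPlus)
open Summit.HodgeConjecture.HodgeConjecture.Cruxes.H413.F0P3cDyRamTableDiagWitnesses (pairing_smul_xPlus_mulVec)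
open scoped Matrix MatrixGroups Valued
open WithZero

variable {K : Type} [Field K] [Valued K ℤᵐ⁰]

/-! ## §1  The arithmetic core: `e·t₊ ≡ e′·t₊·N(a) (mod ϖ^{m*})` forces `e∕e′ ∈ N(E^×)` -/

/-- **`e·t₊ ≡ e′·t₊·N(a) (mod ϖ^{m*}) ⇒ e∕e′ IS A NORM.**  Complete sheet datum `IsRamifiedQuadraticDatum σ ϖ d t`, `m* = d % 2 + 2d − 1`, `t₊ = (ϖ − σϖ)·((ϖσϖ)^{⌊d∕2⌋})⁻¹`
(`|t₊| = exp(−ℓ₀)`), `e, e′` `σ`-FIXED UNITS, any `a`: from `|(ϖ^{m*})⁻¹·(e·t₊ − e′·(t₊·N(a)))| ≤ 1` the `σ`-fixed unit `u = e′·N(a)∕e` has `|1 − u| ≤ |ϖ|^{2d−1}`, hence (even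
valuation) `≤ |ϖ|^{2d}`, so `u` is a norm (★ `exists_mul_map_eq_of_isRamifiedQuadraticDatum`) and `e∕e′ = N(a)∕u = N(a∕z)`.  The two-sided, membership-shaped core of ★
`not_labelPlus_smul_xPlus`. [cite: Serre1979, Ch. V §3 Cor. 3] [cite: Rogawski1990, §4.9 Prop. 4.9.1 (b) p. 55] -/
theorem exists_norm_eq_div_of_near [IsAdicComplete 𝓂[K] 𝒪[K]] {σ : K →+* K} {ϖ : K} {d t : ℕ} (hD : IsRamifiedQuadraticDatum σ ϖ d t)
    {e e' a : K} (hσe : σ e = e) (he1 : Valued.v e = 1) (hσe' : σ e' = e') (he'1 : Valued.v e' = 1)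
    (h : Valued.v ((ϖ ^ (d % 2 + 2 * d - 1))⁻¹ *
      (e * ((ϖ - σ ϖ) * ((ϖ * σ ϖ) ^ ((d - d % 2) / 2))⁻¹) - e' * (((ϖ - σ ϖ) * ((ϖ * σ ϖ) ^ ((d - d % 2) / 2))⁻¹) * (a * σ a)))) ≤ 1) :
    ∃ z : K, z * σ z = e * e'⁻¹ := by
  obtain ⟨hσσ, hvσ, hϖ, heven, hd, h1d, -⟩ := id hD
  obtain ⟨tp, htpdef⟩ : ∃ tp : K, (ϖ - σ ϖ) * ((ϖ * σ ϖ) ^ ((d - d % 2) / 2))⁻¹ = tp := ⟨_, rfl⟩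
  have htp : Valued.v tp = exp (-((d % 2 : ℕ) : ℤ)) := by rw [← htpdef]; exact v_refSkewScalar hvσ hϖ hd
  have he0 : e ≠ 0 := fun h0 => by rw [h0, map_zero] at he1; exact zero_ne_one he1
  have he'0 : e' ≠ 0 := fun h0 => by rw [h0, map_zero] at he'1; exact zero_ne_one he'1
  rw [htpdef, v_inv_varpi_pow_mul_le_one_iff hϖ] at h
  -- `u := e′·N(a)·e⁻¹`, `σ`-fixed; `e·t₊ − e′·t₊·N(a) = t₊·e·(1 − u)`
  obtain ⟨u, hudef⟩ : ∃ u : K, e' * (a * σ a) * e⁻¹ = u := ⟨_, rfl⟩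
  have hσu : σ u = u := by rw [← hudef, map_mul, map_mul, map_mul, map_inv₀, hσe', hσe, hσσ, mul_comm (σ a) a]
  have hfact : e * tp - e' * (tp * (a * σ a)) = tp * e * (1 - u) := by
    rw [← hudef]; field_simp
  rw [hfact, map_mul, map_mul, htp, he1, mul_one] at h
  -- `|1 − u| ≤ |ϖ|^{2d}` by parity
  have hu1 : Valued.v (u - 1) ≤ Valued.v ϖ ^ (2 * d) := by
    rw [v_varpi_pow hϖ, ← Valuation.map_sub_swap]
    by_cases h0 : 1 - u = 0
    · rw [h0, map_zero]; exact zero_le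
    · have hfix : σ (1 - u) = 1 - u := by rw [map_sub, map_one, hσu]
      obtain ⟨n, hn⟩ := heven (1 - u) hfix h0
      rw [hn] at h ⊢
      rw [← exp_add, exp_le_exp] at h
      rw [exp_le_exp]
      push_cast at h ⊢
      omega
  obtain ⟨z, hz, -⟩ := exists_mul_map_eq_of_isRamifiedQuadraticDatum σ ϖ d t hD u hσu hu1
  -- `u ≠ 0` (else `|1| ≤ exp(−(2d−1))`), hence `a ≠ 0`, `z ≠ 0`
  have hu0 : u ≠ 0 := by
    intro hu0
    rw [hu0, sub_zero, map_one, mul_one, exp_le_exp] at h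
    push_cast at h
    omega
  have ha0 : a ≠ 0 := by
    intro ha0; apply hu0; rw [← hudef, ha0, zero_mul, mul_zero, zero_mul]
  have hz0 : z ≠ 0 := by
    intro hz0; apply hu0; rw [← hz, hz0, zero_mul]
  have hσz0 : σ z ≠ 0 := (map_ne_zero σ).2 hz0
  refine ⟨a * z⁻¹, ?_⟩
  rw [map_mul, map_inv₀]
  have hNa : a * σ a = u * e * e'⁻¹ := by
    rw [← hudef]; field_simp
  calc a * z⁻¹ * (σ a * (σ z)⁻¹) = (a * σ a) * (z * σ z)⁻¹ := by rw [mul_inv]; ring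
    _ = u * e * e'⁻¹ * u⁻¹ := by rw [hNa, hz]
    _ = e * e'⁻¹ := by field_simp

/-! ## §2  Membership form -/

/-- **`e·t₊ ∈ valueSetMod σ ϖ m* (e′ • X₊) ⇒ e∕e′ ∈ N(E^×)`** for `σ`-fixed units `e, e′` (★ (L-lab-3) `valueSetMod_smul_xPlus` + §1).
[cite: Serre1979, Ch. V §3 Cor. 3] [cite: LanglandsShelstad1987, §3] -/
theorem exists_norm_of_mem_valueSetMod_smul_xPlus [IsAdicComplete 𝓂[K] 𝒪[K]] {σ : K →+* K} {ϖ : K} {d t : ℕ} (hD : IsRamifiedQuadraticDatum σ ϖ d t)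
    {e e' : K} (hσe : σ e = e) (he1 : Valued.v e = 1) (hσe' : σ e' = e') (he'1 : Valued.v e' = 1)
    (hmem : e * ((ϖ - σ ϖ) * ((ϖ * σ ϖ) ^ ((d - d % 2) / 2))⁻¹) ∈ valueSetMod σ ϖ (d % 2 + 2 * d - 1) (e' • xPlus σ ϖ d)) :
    ∃ z : K, z * σ z = e * e'⁻¹ := by
  rw [valueSetMod_smul_xPlus] at hmem
  obtain ⟨a, -, ha⟩ := hmem
  exact exists_norm_eq_div_of_near hD hσe he1 hσe' he'1 ha

/-- The scalar itself is a value: `e·t₊ ∈ valueSetMod σ ϖ m (e • X₊)` (at `y = e₂`), every level `m`. [cite: Rogawski1990, §4.9 Prop. 4.9.1 (b) p. 55] -/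
theorem smul_refSkewScalar_mem_valueSetMod_smul_xPlus (σ : K →+* K) (ϖ : K) (d m : ℕ) (e : K) :
    e * ((ϖ - σ ϖ) * ((ϖ * σ ϖ) ^ ((d - d % 2) / 2))⁻¹) ∈ valueSetMod σ ϖ m (e • xPlus σ ϖ d) := by
  rw [valueSetMod_smul_xPlus]
  refine ⟨1, by rw [map_one], ?_⟩
  rw [map_one, mul_one, mul_one, sub_self, mul_zero, map_zero]
  exact zero_le_one

/-! ## §3  The two-class obstruction on `𝒪³` (the piece predicate) -/

/-- **THE TWO-CLASS OBSTRUCTION.**  Complete sheet datum, `m* = d % 2 + 2d − 1`.  If the `ϖ^{m*}`-thickened value set of `X` on `𝒪³` contains `e₁·t₊` and `e₂·t₊` for `σ`-fixed units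
`e₁, e₂` with `e₁∕e₂ ∉ N(E^×)`, then it equals `valueSetMod σ ϖ m* (c • X₊)` for NO `σ`-fixed unit `c` (else `e₁∕c`, `e₂∕c`, hence `e₁∕e₂`, would be norms).
[cite: Serre1979, Ch. V §3 Cor. 3] [cite: Rogawski1990, §4.9 Prop. 4.9.1 (b) p. 55] [cite: LanglandsShelstad1987, §3] -/
theorem valueSetMod_ne_smul_xPlus_of_two_classes [IsAdicComplete 𝓂[K] 𝒪[K]] {σ : K →+* K} {ϖ : K} {d t : ℕ} (hD : IsRamifiedQuadraticDatum σ ϖ d t)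
    {X : Matrix (Fin 3) (Fin 3) K} {e₁ e₂ : K} (hσe₁ : σ e₁ = e₁) (he₁1 : Valued.v e₁ = 1) (hσe₂ : σ e₂ = e₂) (he₂1 : Valued.v e₂ = 1)
    (hne : ∀ z : K, z * σ z ≠ e₁ * e₂⁻¹)
    (h₁ : e₁ * ((ϖ - σ ϖ) * ((ϖ * σ ϖ) ^ ((d - d % 2) / 2))⁻¹) ∈ valueSetMod σ ϖ (d % 2 + 2 * d - 1) X)
    (h₂ : e₂ * ((ϖ - σ ϖ) * ((ϖ * σ ϖ) ^ ((d - d % 2) / 2))⁻¹) ∈ valueSetMod σ ϖ (d % 2 + 2 * d - 1) X)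
    {c : K} (hσc : σ c = c) (hc1 : Valued.v c = 1) :
    valueSetMod σ ϖ (d % 2 + 2 * d - 1) X ≠ valueSetMod σ ϖ (d % 2 + 2 * d - 1) (c • xPlus σ ϖ d) := by
  obtain ⟨hσσ, -, -, -, -, -, -⟩ := id hD
  intro hEq
  rw [hEq] at h₁ h₂
  obtain ⟨z₁, hz₁⟩ := exists_norm_of_mem_valueSetMod_smul_xPlus hD hσe₁ he₁1 hσc hc1 h₁
  obtain ⟨z₂, hz₂⟩ := exists_norm_of_mem_valueSetMod_smul_xPlus hD hσe₂ he₂1 hσc hc1 h₂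
  have hc0 : c ≠ 0 := fun h0 => by rw [h0, map_zero] at hc1; exact zero_ne_one hc1
  have he₂0 : e₂ ≠ 0 := fun h0 => by rw [h0, map_zero] at he₂1; exact zero_ne_one he₂1
  have hz₂0 : z₂ ≠ 0 := by
    intro h0
    rw [h0, zero_mul] at hz₂
    exact (mul_ne_zero he₂0 (inv_ne_zero hc0)) hz₂.symm
  have hσz₂0 : σ z₂ ≠ 0 := (map_ne_zero σ).2 hz₂0
  refine hne (z₁ * z₂⁻¹) ?_
  rw [map_mul, map_inv₀]
  calc z₁ * z₂⁻¹ * (σ z₁ * (σ z₂)⁻¹) = (z₁ * σ z₁) * (z₂ * σ z₂)⁻¹ := by rw [mul_inv]; ring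
    _ = (e₁ * c⁻¹) * (e₂ * c⁻¹)⁻¹ := by rw [hz₁, hz₂]
    _ = e₁ * e₂⁻¹ := by field_simp

/-- In particular such an `X` has **no `LabelPlus`** at the level of record (`c = 1`). [cite: Rogawski1990, §4.9 Prop. 4.9.1 (b) p. 55] -/
theorem not_labelPlus_of_two_classes [IsAdicComplete 𝓂[K] 𝒪[K]] {σ : K →+* K} {ϖ : K} {d t : ℕ} (hD : IsRamifiedQuadraticDatum σ ϖ d t)
    {X : Matrix (Fin 3) (Fin 3) K} {e₁ e₂ : K} (hσe₁ : σ e₁ = e₁) (he₁1 : Valued.v e₁ = 1) (hσe₂ : σ e₂ = e₂) (he₂1 : Valued.v e₂ = 1)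
    (hne : ∀ z : K, z * σ z ≠ e₁ * e₂⁻¹)
    (h₁ : e₁ * ((ϖ - σ ϖ) * ((ϖ * σ ϖ) ^ ((d - d % 2) / 2))⁻¹) ∈ valueSetMod σ ϖ (d % 2 + 2 * d - 1) X)
    (h₂ : e₂ * ((ϖ - σ ϖ) * ((ϖ * σ ϖ) ^ ((d - d % 2) / 2))⁻¹) ∈ valueSetMod σ ϖ (d % 2 + 2 * d - 1) X) :
    ¬ LabelPlus σ ϖ d (d % 2 + 2 * d - 1) X := by
  intro hL
  refine valueSetMod_ne_smul_xPlus_of_two_classes hD hσe₁ he₁1 hσe₂ he₂1 hne h₁ h₂ (map_one σ) (map_one Valued.v) ?_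
  rw [one_smul]
  exact hL

/-! ## §4  The two-class obstruction at a lattice (the census predicate) -/

/-- **THE TWO-CLASS OBSTRUCTION AT A LATTICE.**  If `latticeValueSetMod σ ϖ m* M X` contains `e₁·t₊` and `e₂·t₊` for `σ`-fixed units with `e₁∕e₂ ∉ N(E^×)`, then it equals
`valueSetMod σ ϖ m* (c • X₊)` for NO `σ`-fixed unit `c`. [cite: Serre1979, Ch. V §3 Cor. 3] [cite: Kottwitz1986BaseChangeUnits, §1 pp. 240–241] [cite: LanglandsShelstad1987, §3] -/
theorem latticeValueSetMod_ne_smul_xPlus_of_two_classes [IsAdicComplete 𝓂[K] 𝒪[K]] {σ : K →+* K} {ϖ : K} {d t : ℕ} (hD : IsRamifiedQuadraticDatum σ ϖ d t)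
    {M : Submodule 𝒪[K] (Fin 3 → K)} {X : Matrix (Fin 3) (Fin 3) K} {e₁ e₂ : K}
    (hσe₁ : σ e₁ = e₁) (he₁1 : Valued.v e₁ = 1) (hσe₂ : σ e₂ = e₂) (he₂1 : Valued.v e₂ = 1) (hne : ∀ z : K, z * σ z ≠ e₁ * e₂⁻¹)
    (h₁ : e₁ * ((ϖ - σ ϖ) * ((ϖ * σ ϖ) ^ ((d - d % 2) / 2))⁻¹) ∈ latticeValueSetMod σ ϖ (d % 2 + 2 * d - 1) M X)
    (h₂ : e₂ * ((ϖ - σ ϖ) * ((ϖ * σ ϖ) ^ ((d - d % 2) / 2))⁻¹) ∈ latticeValueSetMod σ ϖ (d % 2 + 2 * d - 1) M X)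
    {c : K} (hσc : σ c = c) (hc1 : Valued.v c = 1) :
    latticeValueSetMod σ ϖ (d % 2 + 2 * d - 1) M X ≠ valueSetMod σ ϖ (d % 2 + 2 * d - 1) (c • xPlus σ ϖ d) := by
  intro hEq
  rw [hEq] at h₁ h₂
  obtain ⟨z₁, hz₁⟩ := exists_norm_of_mem_valueSetMod_smul_xPlus hD hσe₁ he₁1 hσc hc1 h₁
  obtain ⟨z₂, hz₂⟩ := exists_norm_of_mem_valueSetMod_smul_xPlus hD hσe₂ he₂1 hσc hc1 h₂
  have hc0 : c ≠ 0 := fun h0 => by rw [h0, map_zero] at hc1; exact zero_ne_one hc1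
  have he₂0 : e₂ ≠ 0 := fun h0 => by rw [h0, map_zero] at he₂1; exact zero_ne_one he₂1
  have hz₂0 : z₂ ≠ 0 := by
    intro h0
    rw [h0, zero_mul] at hz₂
    exact (mul_ne_zero he₂0 (inv_ne_zero hc0)) hz₂.symm
  have hσz₂0 : σ z₂ ≠ 0 := (map_ne_zero σ).2 hz₂0
  refine hne (z₁ * z₂⁻¹) ?_
  rw [map_mul, map_inv₀]
  calc z₁ * z₂⁻¹ * (σ z₁ * (σ z₂)⁻¹) = (z₁ * σ z₁) * (z₂ * σ z₂)⁻¹ := by rw [mul_inv]; ring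
    _ = (e₁ * c⁻¹) * (e₂ * c⁻¹)⁻¹ := by rw [hz₁, hz₂]
    _ = e₁ * e₂⁻¹ := by field_simp

/-- In particular **no `LatticeLabelPlus`** at such a vertex. [cite: Rogawski1990, §4.9 Prop. 4.9.1 (b) p. 55] [cite: Kottwitz1986BaseChangeUnits, §1 pp. 240–241] -/
theorem not_latticeLabelPlus_of_two_classes [IsAdicComplete 𝓂[K] 𝒪[K]] {σ : K →+* K} {ϖ : K} {d t : ℕ} (hD : IsRamifiedQuadraticDatum σ ϖ d t)
    {M : Submodule 𝒪[K] (Fin 3 → K)} {X : Matrix (Fin 3) (Fin 3) K} {e₁ e₂ : K}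
    (hσe₁ : σ e₁ = e₁) (he₁1 : Valued.v e₁ = 1) (hσe₂ : σ e₂ = e₂) (he₂1 : Valued.v e₂ = 1) (hne : ∀ z : K, z * σ z ≠ e₁ * e₂⁻¹)
    (h₁ : e₁ * ((ϖ - σ ϖ) * ((ϖ * σ ϖ) ^ ((d - d % 2) / 2))⁻¹) ∈ latticeValueSetMod σ ϖ (d % 2 + 2 * d - 1) M X)
    (h₂ : e₂ * ((ϖ - σ ϖ) * ((ϖ * σ ϖ) ^ ((d - d % 2) / 2))⁻¹) ∈ latticeValueSetMod σ ϖ (d % 2 + 2 * d - 1) M X) :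
    ¬ LatticeLabelPlus σ ϖ d (d % 2 + 2 * d - 1) M X := by
  intro hL
  refine latticeValueSetMod_ne_smul_xPlus_of_two_classes hD hσe₁ he₁1 hσe₂ he₂1 hne h₁ h₂ (map_one σ) (map_one Valued.v) ?_
  rw [one_smul]
  exact hL

end Summit.HodgeConjecture.HodgeConjecture.Cruxes.H413.F0P3cDyRamValueSetTwoClassObstruction

end
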